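/-
Origin: expansion seat `planner-pub-hodgecm-mc-axioms-1-g14-0`, handover #W213 2026-08-20T15:53:55Z md5 a505bdb757d8 (PKG c3aa6bc2e7d3 → a505bdb757d8; 186 l.; MECHANICAL (iib-R) rewrite v3.1 of the PKG file as it stands (10 token edits; rules R1x1+RX[h₂]x9)) (`HOME/mc/pub-hodgecm-mc-axioms-1-g14/revendor/kit-r55/stage55/HodgeCM/Model/Binders/Real34TorusZero.lean`, md5 a505bdb757d8, 186 lines);
landed by the gen-22 packager (p-g22) in gate run 55 REPLACES the earlier landed copy of `HodgeCM/Model/Binders/Real34TorusZero.lean` (seat copy carried the packager Origin header of an earlier run (stripped)).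
-/
/-
Origin: speedrun cell pub-hodgecm, MODEL-CONSTRUCTION sub-cell, unit pub-hodgecm-mc-binder-1-g11 (BINDER PROVER, gen 11; row 15, piece (Z) of
K34-HWEDGE.md §3: unmatched torus eigenvectors have zero (34) periods), seat prover-pub-hodgecm-mc-binder-1-g11-0, 2026-08-20.
Target in PKG: HodgeCM/Model/Binders/Real34TorusZero.lean (NEW additive leaf; imports RUN-37 `Binders/Real34Seesaw` only).  KERNEL ONLY:
theorems; 0 records, nothing cited, 0 `def … : Prop`, MODEL-N ±0, E unchanged.  Nothing here is a claim of the manuscripts under adjudication.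
-/
import Summits.HodgeConjecture.HodgeCM.Model.Binders.Real34Seesaw

/-!
# (Z) The (34) torus period of a torus EIGENVECTOR of the wrong character vanishes

For the W-block `W : WmInput V D` and a point `t₀` of the (34) torus `T(𝔸)`:

* § 1 `thetaW₃₄_rho_jT₃₄` — `θ^W_{ρ(1, t₀)Ψ}(x, t) = θ^W_Ψ(x, t·t₀)` (`W.ρ` is a representation, `eW ∘ jT₃₄` a homomorphism), and its descent
  `thetaWQ₃₄_rho_jT₃₄`;
* § 2 **`torusPeriodW₃₄_rho_jT₃₄`** — `∫_{[T]} χ · θ^W_{ρ(1,t₀)Ψ}(x, ·) = χ([t₀])⁻¹ · ∫_{[T]} χ · θ^W_Ψ(x, ·)` (right-invariance of the product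
  probability Haar measure on `[U(W₃)] × [U(W₄)]`, multiplicativity of `χ`);
* § 3 **`torusPeriodW₃₄_eq_zero_of_eigen`** — if `ρ(1, t₀) Ψ = λ • Ψ` with `λ · χ([t₀]) ≠ 1` then `torusPeriodW₃₄ W χ Ψ x = 0` for every `x`;
* § 4 at the pins: **`t34_ϑ_eq_zero_of_torusPeriodW₃₄_eq_zero`** and **`t34_ϑ_eq_zero_of_eigen`** — E's (34) generator `ϑ₃₄(χ, Φ)` of such a
  test function is `0` (junction `t34_ϑc_mk_eq_smul_torusPeriodW₃₄`, binder-1-g6).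

USE (row 15, `Real34CensusSideT.hwedgeT`, RUN-44 #41): binder-2's inserted printed pure tensors are `T₃₄(ℝ)`-eigenvectors (`omg_insM` + the local
`eigen`/`ω := vac • π` fields); those of character ≠ `χ_∞⁻¹` ("unmatched letters", e.g. every `P_b^k`, `k ≥ 1`, at a W-indefinite real place)
therefore have `ϑ₃₄(χ, ·) = 0`, so `Ψ := 0` witnesses `hwedgeT` for them.
-/

set_option autoImplicit false

noncomputable section

open MeasureTheory NumberField
open scoped InnerProductSpace ENNReal

attribute [-instance] Quotient.instMeasurableSpace

namespace HodgeCM.Model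

open HodgeCM HodgeCM.Universe HodgeCM.PerL34.Annihilation
open Literature.NumberTheory.Weil1964
open Literature.NumberTheory.Automorphic (piSchwartzBruhat)

section General

variable {L : CMField} {ι₁ : L →+* ℂ} {V : HermSpace3 L ι₁} {D : StubTree.SeesawDatum L} (W : WmInput V D)

local notation3 "L⁺" => maximalRealSubfield (L : Type)

/-! ## 1. Translating the test function by a torus point translates the kernel -/

/-- **`θ^W_{ρ(1, t₀)Ψ}(x, t) = θ^W_Ψ(x, t·t₀)`.** -/
theorem thetaW₃₄_rho_jT₃₄ (Ψ : piSchwartzBruhat W.F W.ι) (x : ↥(Adelic.adelicUnitaryGroup L V.Hm)) (t₀ t : SeesawTorus L⁺ L) :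
    thetaW₃₄ W ((W.ρ (1, W.eW (D.jT₃₄ t₀)) : Module.End ℂ (piSchwartzBruhat W.F W.ι)) Ψ) x t = thetaW₃₄ W Ψ x (t * t₀) := by
  rw [thetaW₃₄_apply, thetaW₃₄_apply, ← Module.End.mul_apply, ← Units.val_mul, ← map_mul, Prod.mk_mul_mk, mul_one, map_mul, map_mul]

/-- the same on the descended kernel `θ^W_Ψ(x, ·) ∈ C([T], ℂ)`. -/
theorem thetaWQ₃₄_rho_jT₃₄ (Ψ : piSchwartzBruhat W.F W.ι) (x : ↥(Adelic.adelicUnitaryGroup L V.Hm)) (t₀ : SeesawTorus L⁺ L)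
    (q : SeesawTorus L⁺ L ⧸ SeesawTorus.rat L⁺ L) :
    thetaWQ₃₄ W ((W.ρ (1, W.eW (D.jT₃₄ t₀)) : Module.End ℂ (piSchwartzBruhat W.F W.ι)) Ψ) x q =
      thetaWQ₃₄ W Ψ x (q * QuotientGroup.mk t₀) := by
  induction q using QuotientGroup.induction_on with
  | H t => rw [← QuotientGroup.mk_mul, thetaWQ₃₄_mk, thetaWQ₃₄_mk, thetaW₃₄_rho_jT₃₄]

/-! ## 2. The torus period of the translated test function -/

/-- `inl (fst t) * inr (snd t) = t` in the product torus. -/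
theorem seesawTorus_inl_fst_mul_inr_snd (t : SeesawTorus L⁺ L) :
    SeesawTorus.inl L⁺ L (SeesawTorus.fst L⁺ L t) * SeesawTorus.inr L⁺ L (SeesawTorus.snd L⁺ L t) = t :=
  Prod.ext (show SeesawTorus.fst L⁺ L t * 1 = _ from mul_one _) (show 1 * SeesawTorus.snd L⁺ L t = _ from one_mul _)

/-- the point of `[U(W₃)] × [U(W₄)]` under `[t₀]`. -/
private def shiftPt (t₀ : SeesawTorus L⁺ L) :
    (relNormOneIdeles L⁺ L ⧸ relNormOneRat L⁺ L) × (relNormOneIdeles L⁺ L ⧸ relNormOneRat L⁺ L) :=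
  (QuotientGroup.mk (SeesawTorus.fst L⁺ L t₀), QuotientGroup.mk (SeesawTorus.snd L⁺ L t₀))

/-- `[u₁u₂] · [t₀] = [(u₁ t₀,₁)(u₂ t₀,₂)]` on `[T]`. -/
private theorem quotInl_mul_quotInr_mul_shift (t₀ : SeesawTorus L⁺ L)
    (p : (relNormOneIdeles L⁺ L ⧸ relNormOneRat L⁺ L) × (relNormOneIdeles L⁺ L ⧸ relNormOneRat L⁺ L)) :
    SeesawTorus.quotInl L⁺ L (p * shiftPt t₀).1 * SeesawTorus.quotInr L⁺ L (p * shiftPt t₀).2 =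
      SeesawTorus.quotInl L⁺ L p.1 * SeesawTorus.quotInr L⁺ L p.2 * QuotientGroup.mk t₀ := by
  have ht₀ : (QuotientGroup.mk t₀ : SeesawTorus L⁺ L ⧸ SeesawTorus.rat L⁺ L) =
      SeesawTorus.quotInl L⁺ L (QuotientGroup.mk (SeesawTorus.fst L⁺ L t₀)) *
        SeesawTorus.quotInr L⁺ L (QuotientGroup.mk (SeesawTorus.snd L⁺ L t₀)) := by
    rw [SeesawTorus.quotInl_mk, SeesawTorus.quotInr_mk, ← QuotientGroup.mk_mul, seesawTorus_inl_fst_mul_inr_snd]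
  rw [ht₀, shiftPt, Prod.fst_mul, Prod.snd_mul, map_mul, map_mul]
  simp only [mul_assoc, mul_left_comm (SeesawTorus.quotInr L⁺ L p.2)]

/-- **`torusPeriodW₃₄ W χ (ρ(1, t₀) Ψ) x = χ([t₀])⁻¹ · torusPeriodW₃₄ W χ Ψ x`** (translation-invariance of the `[T]`-integral). -/
theorem torusPeriodW₃₄_rho_jT₃₄ (χ : PontryaginDual (SeesawTorus L⁺ L ⧸ SeesawTorus.rat L⁺ L)) (Ψ : piSchwartzBruhat W.F W.ι)
    (x : ↥(Adelic.adelicUnitaryGroup L V.Hm)) (t₀ : SeesawTorus L⁺ L) :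
    torusPeriodW₃₄ W χ ((W.ρ (1, W.eW (D.jT₃₄ t₀)) : Module.End ℂ (piSchwartzBruhat W.F W.ι)) Ψ) x =
      (dualChar χ (QuotientGroup.mk t₀))⁻¹ * torusPeriodW₃₄ W χ Ψ x := by
  have hχ : dualChar χ (QuotientGroup.mk t₀) ≠ 0 := by
    rw [dualChar_apply]; exact Circle.coe_ne_zero _
  -- the translated integrand is `χ([t₀])⁻¹ · F(p · shiftPt t₀)`, `F` the original integrand
  have hF : ∀ p : (relNormOneIdeles L⁺ L ⧸ relNormOneRat L⁺ L) × (relNormOneIdeles L⁺ L ⧸ relNormOneRat L⁺ L),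
      dualChar χ (SeesawTorus.quotInl L⁺ L p.1 * SeesawTorus.quotInr L⁺ L p.2) *
          thetaWQ₃₄ W ((W.ρ (1, W.eW (D.jT₃₄ t₀)) : Module.End ℂ (piSchwartzBruhat W.F W.ι)) Ψ) x
            (SeesawTorus.quotInl L⁺ L p.1 * SeesawTorus.quotInr L⁺ L p.2) =
        (dualChar χ (QuotientGroup.mk t₀))⁻¹ *
          (dualChar χ (SeesawTorus.quotInl L⁺ L (p * shiftPt t₀).1 * SeesawTorus.quotInr L⁺ L (p * shiftPt t₀).2) *
            thetaWQ₃₄ W Ψ x (SeesawTorus.quotInl L⁺ L (p * shiftPt t₀).1 * SeesawTorus.quotInr L⁺ L (p * shiftPt t₀).2)) := by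
    intro p
    rw [thetaWQ₃₄_rho_jT₃₄, quotInl_mul_quotInr_mul_shift]
    set a := SeesawTorus.quotInl L⁺ L p.1 * SeesawTorus.quotInr L⁺ L p.2 with ha
    rw [map_mul (dualChar χ) a, mul_comm (dualChar χ a) (dualChar χ (QuotientGroup.mk t₀)),
      mul_assoc (dualChar χ (QuotientGroup.mk t₀)), inv_mul_cancel_left₀ hχ]
  unfold torusPeriodW₃₄
  simp_rw [hF]
  rw [integral_const_mul]
  congr 1
  exact integral_mul_right_eq_self
    (fun p : (relNormOneIdeles L⁺ L ⧸ relNormOneRat L⁺ L) × (relNormOneIdeles L⁺ L ⧸ relNormOneRat L⁺ L) =>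
      dualChar χ (SeesawTorus.quotInl L⁺ L p.1 * SeesawTorus.quotInr L⁺ L p.2) *
        thetaWQ₃₄ W Ψ x (SeesawTorus.quotInl L⁺ L p.1 * SeesawTorus.quotInr L⁺ L p.2)) (shiftPt t₀)

/-! ## 3. Eigenvectors of the wrong character have zero torus period -/

/-- **If `ρ(1, t₀) Ψ = λ • Ψ` with `λ · χ([t₀]) ≠ 1` then `torusPeriodW₃₄ W χ Ψ x = 0`.** -/
theorem torusPeriodW₃₄_eq_zero_of_eigen (χ : PontryaginDual (SeesawTorus L⁺ L ⧸ SeesawTorus.rat L⁺ L)) (Ψ : piSchwartzBruhat W.F W.ι)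
    (t₀ : SeesawTorus L⁺ L) (lam : ℂ)
    (hΨ : ((W.ρ (1, W.eW (D.jT₃₄ t₀)) : Module.End ℂ (piSchwartzBruhat W.F W.ι)) Ψ) = lam • Ψ)
    (hne : lam * dualChar χ (QuotientGroup.mk t₀) ≠ 1) (x : ↥(Adelic.adelicUnitaryGroup L V.Hm)) :
    torusPeriodW₃₄ W χ Ψ x = 0 := by
  have hχ : dualChar χ (QuotientGroup.mk t₀) ≠ 0 := by
    rw [dualChar_apply]; exact Circle.coe_ne_zero _
  have h := torusPeriodW₃₄_rho_jT₃₄ W χ Ψ x t₀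
  rw [hΨ, torusPeriodW₃₄_smul] at h
  have h2 : dualChar χ (QuotientGroup.mk t₀) * (lam * torusPeriodW₃₄ W χ Ψ x) = torusPeriodW₃₄ W χ Ψ x := by
    rw [h, ← mul_assoc, mul_inv_cancel₀ hχ, one_mul]
  have h3 : (lam * dualChar χ (QuotientGroup.mk t₀) - 1) * torusPeriodW₃₄ W χ Ψ x = 0 := by
    linear_combination h2
  exact (mul_eq_zero.1 h3).resolve_left (sub_ne_zero.2 hne)

end General

/-! ## 4. At the pins: E's (34) generator of such a test function vanishes -/

section Pin

open Literature.AlgebraicGeometry.HodgeTheory Literature.NumberTheory.Automorphic.PicardCM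

variable (hHD : exists_isReal_hodgeModel) (hI : hodgePQ_independent_of_hodgeModel)
  (h₁ : BallQuotientUniformised)  (h₃ : CMAbelianVarietyRealised)
variable (h : Bool) (hA : Literature.NumberTheory.Transcendental.Arapura2012_Cor_15_4_6)
  (W : ∀ {L : CMField} {ι₁ : L →+* ℂ} (V : HermSpace3 L ι₁) (c : SeesawCtx L), WmInput V c.D)
  (S : ∀ {L : CMField} {ι₁ : L →+* ℂ} (V : HermSpace3 L ι₁) (c : SeesawCtx L), ThetaAdelicSide V c)
  (μ : ∀ {L : CMField}, SeesawCtx L → Fin 4 → InfinitePlace L → ℤ)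

variable {L : CMField} {ι₁ : L →+* ℂ} (V : HermSpace3 L ι₁) (c : SeesawCtx L)

local notation3 "L⁺" => maximalRealSubfield (L : Type)

/-- if every W-block torus period of `Φ` against `χ` vanishes, so does E's (34) generator `ϑ₃₄(χ, Φ)`. -/
theorem t34_ϑ_eq_zero_of_torusPeriodW₃₄_eq_zero (hW : IsAnisotropic L c.D.gramW)
    (χ : ((pinT hHD hI h₁ h₃ h hA W S μ).t34 V c).X) (Φ : (pinT hHD hI h₁ h₃ h hA W S μ).SK V c)
    (h0 : ∀ x : ↥(Adelic.regimeSubgroup L V.Hm), torusPeriodW₃₄ (W V c) χ.1 Φ.1 (x : ↥(Adelic.adelicUnitaryGroup L V.Hm)) = 0) :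
    ((pinT hHD hI h₁ h₃ h hA W S μ).t34 V c).ϑ χ Φ = 0 := by
  have hcm : (pinR34 hHD hI h₁ h₃ h hA W S μ V c).kt.ϑc χ Φ = 0 := by
    ext q
    induction q using QuotientGroup.induction_on with
    | H x => rw [ContinuousMap.zero_apply, t34_ϑc_mk_eq_smul_torusPeriodW₃₄ hHD hI h₁ h₃ h hA W S μ V c hW χ Φ x, h0 x, smul_zero]
  rw [t34_ϑ_eq_toLp, hcm]
  exact map_zero _

/-- **E's (34) generator of a torus EIGENVECTOR of the wrong character is `0`**: `ρ(1, eW (jT₃₄ t₀)) Φ = λ • Φ` and `λ · χ([t₀]) ≠ 1`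
give `ϑ₃₄(χ, Φ) = 0` (piece (Z) of row 15's `hwedgeT`: take `Ψ := 0`). -/
theorem t34_ϑ_eq_zero_of_eigen (hW : IsAnisotropic L c.D.gramW)
    (χ : ((pinT hHD hI h₁ h₃ h hA W S μ).t34 V c).X) (Φ : (pinT hHD hI h₁ h₃ h hA W S μ).SK V c)
    (t₀ : SeesawTorus L⁺ L) (lam : ℂ)
    (hΦ : (((W V c).ρ (1, (W V c).eW (c.D.jT₃₄ t₀)) : Module.End ℂ (piSchwartzBruhat (W V c).F (W V c).ι))
        (Φ.1 : piSchwartzBruhat (W V c).F (W V c).ι)) =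
        @HSMul.hSMul ℂ (piSchwartzBruhat (W V c).F (W V c).ι) (piSchwartzBruhat (W V c).F (W V c).ι) _ lam Φ.1)
    (hne : lam * dualChar χ.1 (QuotientGroup.mk t₀) ≠ 1) :
    ((pinT hHD hI h₁ h₃ h hA W S μ).t34 V c).ϑ χ Φ = 0 :=
  t34_ϑ_eq_zero_of_torusPeriodW₃₄_eq_zero hHD hI h₁ h₃ h hA W S μ V c hW χ Φ fun x =>
    torusPeriodW₃₄_eq_zero_of_eigen (W V c) χ.1 Φ.1 t₀ lam hΦ hne x

end Pin

end HodgeCM.Model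

end
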